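import Literature.NumberTheory.EllipticCurves.DivisionField
import Literature.NumberTheory.EllipticCurves.TorsionCardinality
import HarnessLib

/-!
# The `p`-division field of an elliptic curve with REDUCIBLE `E[p]` is a `p`-extension of an
# ABELIAN field: the Borel kernel of a rational line (theorems + two definitions, no named fact)

Topic `NumberTheory/EllipticCurves` (namespace `WeierstrassCurve`, dot-notation on the curve, as in
`DivisionField.lean`).  Written by the prover seat `bsd-potss-rkm` g15 (cell `bsd-potss`, item
stmt-BirchSwinnertonDyer-19196 `ReducibleKatoMember`, crux M of the routes K9 / K8-t′) as the kernel half
of Wuthrich's Lemma 14 (C. Wuthrich, Doc. Math. 19 (2014), p. 396: «If `E` admits an isogeny of degree `p`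
defined over `ℚ`, then the fine Selmer group `R(E/ℚ_∞)` is a finitely generated `ℤ_p`-module», proof:
«the two characters of `E[p]` cut out abelian fields» + Ferrero–Washington + Coates–Sujatha), i.e. of the
printed antecedent of the clause `mu_H2` of `Kato2004.MemberHullZetaInputs`.  The Iwasawa-theoretic
half (Coates–Sujatha 2005 Thm. 3.4 / Lim 2017 §3) is a named fact elsewhere; THIS file is pure Galois
theory of the mod-`p` representation and is proved outright.

## Mathematics

Let `K` be a field of characteristic `0`, `E/K` elliptic, `p` a prime, `V = E[p] = E(K̄)[p]` with its
action of `Γ_K = Gal(K̄/K)`, and `C ≤ V` a `Γ_K`-stable subgroup with `C ≠ 0, V` (i.e. `E[p]` is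
REDUCIBLE, `¬ W.HasIrreducibleModPGaloisRep p`; `#V = p²` forces `#C = p`).  In a basis adapted to `C`
the representation is `ρ̄ = (χ₁ *; 0 χ₂)` and we consider

* `W.borelKernel C = {σ ∈ Γ_K : σ|_C = 1 and (σ − 1)V ⊆ C}` — the kernel of `(χ₁, χ₂) : Γ_K → (𝔽_p^×)²`
  (`borelKernel`; a subgroup for ANY `C`, open, containing `Γ_{K(E[p])}`; normal when `C` is stable);
* `W.borelField C = K̄^{borelKernel C} = K(χ₁, χ₂)` (`borelField`), a finite Galois extension of `K`
  inside `K(E[p])`.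

Results (all PROVED): every commutator of `Γ_K` lies in `borelKernel C`
(`commutator_mem_borelKernel`: `Γ_K` acts on the cyclic groups `C` and `V/C` of prime order through
scalars), hence **`K(χ₁,χ₂)/K` is ABELIAN** (`isAbelianGalois_borelField`, Mathlib `IsAbelianGalois`);
`σ ↦ σy₀ − y₀` (`y₀ ∉ C`) is a homomorphism `borelKernel C → C` with kernel `Γ_{K(E[p])}`, hence
**`[K(E[p]) : K(χ₁,χ₂)] ∈ {1, p}`** (`relIndex_fixingSubgroupOfModule_borelKernel_dvd`,
`exists_finrank_divisionField_eq_pow_mul_finrank_borelField`); packaged for a number field `K` and a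
reducible `E[p]` as `exists_abelian_le_divisionField_of_not_irreducible`:
there is `M ≤ K(E[p])`, finite ABELIAN Galois over `K`, with `[K(E[p]) : K] = p^k · [M : K]`, `k ≤ 1`.
This is the sentence «`ℚ(E[p])` is a `p`-extension of the abelian field `ℚ(χ₁, χ₂)`» used with
Ferrero–Washington in Wuthrich 2014 L.14, Coates–Sujatha 2005 Cor. 3.6, Lim 2017 Thm. 3.5 / Remark (a).

References: [Wuthrich2014] Lemma 14 (p. 396); [CoatesSujatha2005] Thm. 3.4, Cor. 3.5–3.6;
[Lim2017FineSelmer] §3 (arXiv:1306.2047 pp. 6–7); [SerreAbelianLadic1968] IV.1.1–1.2 (the image of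
`Γ_K` in `Aut(E[p])`); [SilvermanAEC2009] III.§7, Cor. III.6.4 (b) (`#E[p] = p²`).
Design: no `instance`, no notation; `IsAbelianGalois` / `IsGalois` / `FiniteDimensional` conclusions
are stated as theorems.  Axioms: `propext`, `Classical.choice`, `Quot.sound`.
-/

set_option autoImplicit false

noncomputable section

open scoped Classical
open Field Literature.NumberTheory.EllipticCurves Literature.NumberTheory.GaloisRepresentations

universe u

namespace WeierstrassCurve

variable {K : Type u} [Field K] (W : WeierstrassCurve K) {p : ℕ}

/-! ### The Borel kernel of a subgroup `C ≤ E[p]` -/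

/-- **The Borel kernel of `C ≤ E[p]`**: the elements of `Γ_K` acting trivially on `C` and on
`E[p]/C`, i.e. `σ|_C = 1` and `σy − y ∈ C` for all `y ∈ E[p]`.  For a `Γ_K`-stable line `C` of a
reducible `E[p]` this is `ker(χ₁) ∩ ker(χ₂)` for `ρ̄ = (χ₁ *; 0 χ₂)`.  (A subgroup for every `C`: if
`σ, τ` fix `C` pointwise then `στy − y = σ(τy − y) + (σy − y) = (τy − y) + (σy − y)`.)
[cite: Wuthrich2014, Lemma 14 (p. 396), proof] [cite: SerreAbelianLadic1968, IV.1.1–1.2] -/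
def borelKernel (C : AddSubgroup (geomTorsion W p)) : Subgroup (absoluteGaloisGroup K) where
  carrier := {σ | (∀ x : geomTorsion W p, x ∈ C → σ • x = x) ∧
    ∀ y : geomTorsion W p, σ • y - y ∈ C}
  one_mem' := ⟨fun x _ => one_smul _ x, fun y => by simp [C.zero_mem]⟩
  mul_mem' := by
    rintro σ τ ⟨hσC, hσV⟩ ⟨hτC, hτV⟩
    refine ⟨fun x hx => by rw [mul_smul, hτC x hx, hσC x hx], fun y => ?_⟩
    have h1 : σ • (τ • y - y) = τ • y - y := hσC _ (hτV y)
    have : (σ * τ) • y - y = (τ • y - y) + (σ • y - y) := by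
      rw [mul_smul, ← h1, smul_sub]; abel
    rw [this]
    exact C.add_mem (hτV y) (hσV y)
  inv_mem' := by
    rintro σ ⟨hσC, hσV⟩
    have hinvC : ∀ x : geomTorsion W p, x ∈ C → σ⁻¹ • x = x := fun x hx => by
      conv_lhs => rw [← hσC x hx]
      rw [inv_smul_smul]
    refine ⟨hinvC, fun y => ?_⟩
    have hmem : σ • (σ⁻¹ • y - y) ∈ C := by
      have : σ • (σ⁻¹ • y - y) = -(σ • y - y) := by rw [smul_sub, smul_inv_smul]; abel
      rw [this]
      exact C.neg_mem (hσV y)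
    have : σ⁻¹ • y - y = σ⁻¹ • (σ • (σ⁻¹ • y - y)) := by rw [inv_smul_smul]
    rw [this, hinvC _ hmem]
    exact hmem

variable {W}

/-- Membership in the Borel kernel (`σ|_C = 1` and `(σ − 1)E[p] ⊆ C`). [cite: SerreAbelianLadic1968, IV.1.1–1.2 (the image of Γ_K in Aut(E[p]))] -/
theorem mem_borelKernel_iff {C : AddSubgroup (geomTorsion W p)} {σ : absoluteGaloisGroup K} :
    σ ∈ W.borelKernel C ↔
      (∀ x : geomTorsion W p, x ∈ C → σ • x = x) ∧ ∀ y : geomTorsion W p, σ • y - y ∈ C :=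
  Iff.rfl

/-- `Γ_{K(E[p])} = ker ρ̄_{E,p}` lies in every Borel kernel. [cite: SerreAbelianLadic1968, IV.1.1–1.2 (ker ρ̄ = Gal(K̄/K(E[p])))] -/
theorem fixingSubgroupOfModule_le_borelKernel (C : AddSubgroup (geomTorsion W p)) :
    fixingSubgroupOfModule K (geomTorsion W p) ≤ W.borelKernel C := by
  intro σ hσ
  rw [mem_fixingSubgroupOfModule_geomTorsion_iff] at hσ
  exact ⟨fun x _ => hσ x, fun y => by rw [hσ y, sub_self]; exact C.zero_mem⟩

/-- The Borel kernel is open in `Γ_K` (`E` elliptic, `p ≠ 0`): it contains the open kernel of the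
mod-`p` representation. [cite: SilvermanAEC2009, VIII.§1 (K(E[m])/K finite Galois)] -/
theorem isOpen_borelKernel [W.IsElliptic] [NeZero p] (C : AddSubgroup (geomTorsion W p)) :
    IsOpen (W.borelKernel C : Set (absoluteGaloisGroup K)) :=
  Subgroup.isOpen_mono (fixingSubgroupOfModule_le_borelKernel C)
    (W.isOpen_fixingSubgroupOfModule_geomTorsion p)

/-- For a `Γ_K`-STABLE `C`, the Borel kernel is normal in `Γ_K` (it is the kernel of `(χ₁, χ₂)`). [cite: SerreAbelianLadic1968, IV.1.1–1.2 (the image of Γ_K in Aut(E[p]))] -/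
theorem borelKernel_normal {C : AddSubgroup (geomTorsion W p)}
    (hC : ∀ (σ : absoluteGaloisGroup K) (x : geomTorsion W p), x ∈ C → σ • x ∈ C) :
    (W.borelKernel C).Normal := by
  refine ⟨fun σ hσ g => ?_⟩
  obtain ⟨hσC, hσV⟩ := hσ
  refine ⟨fun x hx => ?_, fun y => ?_⟩
  · rw [mul_smul, mul_smul, hσC _ (hC g⁻¹ x hx), smul_inv_smul]
  · have : (g * σ * g⁻¹) • y - y = g • (σ • (g⁻¹ • y) - g⁻¹ • y) := by
      rw [smul_sub, smul_inv_smul, mul_smul, mul_smul]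
    rw [this]
    exact hC g _ (hσV _)

/-! ### Scalar actions on `C` and on `E[p]/C` when `#C = p`, `#E[p] = p²` -/

section Scalars

variable {C : AddSubgroup (geomTorsion W p)}

/-- `Γ_K` commutes with integer multiples on `E[p]`. [folklore] -/
private theorem smul_zsmul_geomTorsion (σ : absoluteGaloisGroup K) (k : ℤ) (x : geomTorsion W p) :
    σ • (k • x) = k • (σ • x) :=
  map_zsmul (DistribSMul.toAddMonoidHom (geomTorsion W p) σ) k x

/-- On a STABLE subgroup `C` of prime order, every `σ ∈ Γ_K` acts as an integer scalar
(`C` is cyclic; `σ` maps a generator into `C`). [cite: SerreAbelianLadic1968, IV.1.1–1.2] -/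
theorem exists_forall_smul_eq_zsmul_of_card_eq [hp : Fact p.Prime]
    (hC : ∀ (σ : absoluteGaloisGroup K) (x : geomTorsion W p), x ∈ C → σ • x ∈ C)
    (hcard : Nat.card C = p) (σ : absoluteGaloisGroup K) :
    ∃ a : ℤ, ∀ x : geomTorsion W p, x ∈ C → σ • x = a • x := by
  haveI : IsAddCyclic C := isAddCyclic_of_prime_card hcard
  obtain ⟨g, hg⟩ := IsAddCyclic.exists_generator (α := C)
  have hσg : σ • (g : geomTorsion W p) ∈ C := hC σ g g.2
  obtain ⟨a, ha⟩ := hg ⟨σ • (g : geomTorsion W p), hσg⟩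
  refine ⟨a, fun x hx => ?_⟩
  obtain ⟨k, hk⟩ := hg ⟨x, hx⟩
  have hk' : (k • g : C) = ⟨x, hx⟩ := hk
  have hx' : x = k • (g : geomTorsion W p) := by
    have := congrArg (fun z : C => (z : geomTorsion W p)) hk'
    simpa using this.symm
  have ha' : σ • (g : geomTorsion W p) = a • (g : geomTorsion W p) := by
    have := congrArg (fun z : C => (z : geomTorsion W p)) ha
    simpa using this.symm
  rw [hx', smul_zsmul_geomTorsion, ha', smul_smul, smul_smul, mul_comm]

/-- If `#C = p` and `#E[p] = p²`, then for `y₀ ∉ C`: `E[p] = C + ℤ y₀` (`E[p] ≅ (ℤ/p)²`). [cite: SilvermanAEC2009, Cor. III.6.4 (b) (E[m] ≅ (ℤ/m)²)] -/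
theorem sup_zmultiples_eq_top_of_not_mem [hp : Fact p.Prime] (hcard : Nat.card C = p)
    (hV : Nat.card (geomTorsion W p) = p ^ 2) {y₀ : geomTorsion W p} (hy₀ : y₀ ∉ C) :
    C ⊔ AddSubgroup.zmultiples y₀ = ⊤ := by
  haveI : Finite (geomTorsion W p) := Nat.finite_of_card_ne_zero (by
    rw [hV]; exact pow_ne_zero 2 hp.out.ne_zero)
  have hCD : C ≤ C ⊔ AddSubgroup.zmultiples y₀ := le_sup_left
  have hy₀D : y₀ ∈ C ⊔ AddSubgroup.zmultiples y₀ :=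
    AddSubgroup.mem_sup_right (AddSubgroup.mem_zmultiples y₀)
  have hne : C ≠ C ⊔ AddSubgroup.zmultiples y₀ := fun h => hy₀ (by rw [h]; exact hy₀D)
  have hdvdV : Nat.card (C ⊔ AddSubgroup.zmultiples y₀ : AddSubgroup (geomTorsion W p)) ∣ p ^ 2 := by
    have h := AddSubgroup.card_addSubgroup_dvd_card (C ⊔ AddSubgroup.zmultiples y₀)
    rwa [hV] at h
  have hdvdC : p ∣ Nat.card (C ⊔ AddSubgroup.zmultiples y₀ : AddSubgroup (geomTorsion W p)) := by
    have h := AddSubgroup.card_dvd_of_le hCD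
    rwa [hcard] at h
  obtain ⟨i, hi, hDi⟩ := (Nat.dvd_prime_pow hp.out).mp hdvdV
  interval_cases i
  · rw [hDi, pow_zero, Nat.dvd_one] at hdvdC
    exact absurd hdvdC hp.out.one_lt.ne'
  · rw [pow_one] at hDi
    exact absurd (AddSubgroup.eq_of_le_of_card_ge hCD (by rw [hDi, hcard])) hne
  · exact AddSubgroup.eq_top_of_card_eq _ (by rw [hDi, hV])

/-- If `#C = p`, `#E[p] = p²` and `C` is stable, every `σ ∈ Γ_K` acts as an integer scalar on
`E[p]/C`: `σy − a'y ∈ C` for all `y`. [cite: SerreAbelianLadic1968, IV.1.1–1.2] -/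
theorem exists_forall_smul_sub_zsmul_mem [hp : Fact p.Prime]
    (hC : ∀ (σ : absoluteGaloisGroup K) (x : geomTorsion W p), x ∈ C → σ • x ∈ C)
    (hcard : Nat.card C = p) (hV : Nat.card (geomTorsion W p) = p ^ 2)
    (σ : absoluteGaloisGroup K) :
    ∃ a : ℤ, ∀ y : geomTorsion W p, σ • y - a • y ∈ C := by
  -- `C ≠ ⊤` (its order is `p < p²`), so pick `y₀ ∉ C`
  have hCtop : C ≠ ⊤ := by
    intro h
    have h1 : Nat.card C = Nat.card (geomTorsion W p) := by
      rw [h]; exact Nat.card_congr (AddSubgroup.topEquiv.toEquiv)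
    rw [hcard, hV] at h1
    have := hp.out.one_lt
    nlinarith
  obtain ⟨y₀, hy₀⟩ : ∃ y₀ : geomTorsion W p, y₀ ∉ C := by
    by_contra h
    push Not at h
    exact hCtop (eq_top_iff.mpr fun y _ => h y)
  have htop := sup_zmultiples_eq_top_of_not_mem hcard hV hy₀
  -- `σ y₀ = c₀ + a • y₀`
  have hσy₀ : σ • y₀ ∈ C ⊔ AddSubgroup.zmultiples y₀ := by rw [htop]; exact AddSubgroup.mem_top _
  obtain ⟨c₀, hc₀, z, hz, hsum⟩ := AddSubgroup.mem_sup.mp hσy₀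
  obtain ⟨a, rfl⟩ := AddSubgroup.mem_zmultiples_iff.mp hz
  refine ⟨a, fun y => ?_⟩
  have hy : y ∈ C ⊔ AddSubgroup.zmultiples y₀ := by rw [htop]; exact AddSubgroup.mem_top _
  obtain ⟨c, hc, z', hz', rfl⟩ := AddSubgroup.mem_sup.mp hy
  obtain ⟨k, rfl⟩ := AddSubgroup.mem_zmultiples_iff.mp hz'
  have hy₀' : σ • y₀ - a • y₀ = c₀ := by rw [← hsum]; abel
  have key : σ • (c + k • y₀) - a • (c + k • y₀) =
      (σ • c - a • c) + k • (σ • y₀ - a • y₀) := by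
    rw [smul_add, smul_zsmul_geomTorsion, smul_add, smul_sub, smul_comm a k y₀]; abel
  rw [key, hy₀']
  exact C.add_mem (C.sub_mem (hC σ c hc) (C.zsmul_mem hc a)) (C.zsmul_mem hc₀ k)

/-- The order of a subgroup `C ≠ ⊥, ⊤` of `E[p]` (`#E[p] = p²`) is `p` (Lagrange in `(ℤ/p)²`). [cite: SilvermanAEC2009, Cor. III.6.4 (b) (E[m] ≅ (ℤ/m)²)] -/
theorem card_eq_of_ne_bot_of_ne_top [hp : Fact p.Prime] (hV : Nat.card (geomTorsion W p) = p ^ 2)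
    (h1 : C ≠ ⊥) (h2 : C ≠ ⊤) : Nat.card C = p := by
  haveI : Finite (geomTorsion W p) := Nat.finite_of_card_ne_zero (by
    rw [hV]; exact pow_ne_zero 2 hp.out.ne_zero)
  have hdvd : Nat.card C ∣ p ^ 2 := hV ▸ AddSubgroup.card_addSubgroup_dvd_card C
  obtain ⟨i, hi, hCi⟩ := (Nat.dvd_prime_pow hp.out).mp hdvd
  have hi0 : i ≠ 0 := by
    rintro rfl
    rw [pow_zero] at hCi
    exact h1 (AddSubgroup.eq_bot_of_card_eq C hCi)
  have hi2 : i ≠ 2 := by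
    rintro rfl
    exact h2 (AddSubgroup.eq_top_of_card_eq C (by rw [hCi, hV]))
  have : i = 1 := by omega
  subst this
  rw [hCi, pow_one]

/-- **Every commutator of `Γ_K` lies in the Borel kernel of a stable line** (`#C = p`,
`#E[p] = p²`): `Γ_K` acts on `C` and on `E[p]/C` through scalars, which commute.
[cite: Wuthrich2014, Lemma 14 (p. 396): «the two characters of `E[p]` cut out abelian fields»] -/
theorem commutator_mem_borelKernel [hp : Fact p.Prime]
    (hC : ∀ (σ : absoluteGaloisGroup K) (x : geomTorsion W p), x ∈ C → σ • x ∈ C)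
    (hcard : Nat.card C = p) (hV : Nat.card (geomTorsion W p) = p ^ 2)
    (σ τ : absoluteGaloisGroup K) :
    σ * τ * σ⁻¹ * τ⁻¹ ∈ W.borelKernel C := by
  obtain ⟨a, ha⟩ := exists_forall_smul_eq_zsmul_of_card_eq hC hcard σ
  obtain ⟨b, hb⟩ := exists_forall_smul_eq_zsmul_of_card_eq hC hcard τ
  obtain ⟨a', ha'⟩ := exists_forall_smul_sub_zsmul_mem hC hcard hV σ
  obtain ⟨b', hb'⟩ := exists_forall_smul_sub_zsmul_mem hC hcard hV τ
  -- on `C` the two actions commute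
  have hcommC : ∀ u : geomTorsion W p, u ∈ C → σ • τ • u = τ • σ • u := by
    intro u hu
    rw [hb u hu, ha _ (C.zsmul_mem hu b), ha u hu, hb _ (C.zsmul_mem hu a), smul_smul, smul_smul,
      mul_comm]
  -- modulo `C` the two actions commute
  have hcommV : ∀ v : geomTorsion W p, σ • τ • v - τ • σ • v ∈ C := by
    intro v
    have e1 : σ • (τ • v - b' • v) = σ • τ • v - b' • σ • v := by
      rw [smul_sub, smul_zsmul_geomTorsion]
    have e2 : τ • (σ • v - a' • v) = τ • σ • v - a' • τ • v := by
      rw [smul_sub, smul_zsmul_geomTorsion]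
    have e3 : b' • (σ • v - a' • v) = b' • σ • v - (b' * a') • v := by
      rw [zsmul_sub, smul_smul]
    have e4 : a' • (τ • v - b' • v) = a' • τ • v - (b' * a') • v := by
      rw [zsmul_sub, smul_smul, mul_comm a' b']
    have key : σ • τ • v - τ • σ • v =
        (σ • (τ • v - b' • v) + b' • (σ • v - a' • v)) -
          (τ • (σ • v - a' • v) + a' • (τ • v - b' • v)) := by
      rw [e1, e2, e3, e4]
      abel
    rw [key]
    exact C.sub_mem (C.add_mem (hC σ _ (hb' v)) (C.zsmul_mem (ha' v) b'))
      (C.add_mem (hC τ _ (ha' v)) (C.zsmul_mem (hb' v) a'))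
  refine ⟨fun x hx => ?_, fun y => ?_⟩
  · have hu : σ⁻¹ • τ⁻¹ • x ∈ C := hC _ _ (hC _ _ hx)
    rw [mul_smul, mul_smul, mul_smul, hcommC _ hu, smul_inv_smul, smul_inv_smul]
  · have h := hcommV (σ⁻¹ • τ⁻¹ • y)
    rw [mul_smul, mul_smul, mul_smul]
    have : τ • σ • σ⁻¹ • τ⁻¹ • y = y := by rw [smul_inv_smul, smul_inv_smul]
    rw [this] at h
    exact h

end Scalars

/-! ### The Borel field `K(χ₁, χ₂)` -/

/-- **The Borel field `K(χ₁, χ₂) ⊆ K̄`** of a subgroup `C ≤ E[p]`: the fixed field of the Borel kernel.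
For a stable line of a reducible `E[p]` it is the compositum of the fields cut out by the two
characters `χ₁` (on `C`) and `χ₂` (on `E[p]/C`). [cite: Wuthrich2014, Lemma 14 (p. 396), proof] -/
def borelField (C : AddSubgroup (geomTorsion W p)) : IntermediateField K (AlgebraicClosure K) :=
  IntermediateField.fixedField (W.borelKernel C)

/-- Unfolding: `K(χ₁, χ₂)` is the fixed field of the Borel kernel. [cite: Wuthrich2014, Lemma 14 (p. 396), proof («the two characters of E[p] cut out abelian fields»)] -/
theorem borelField_def (C : AddSubgroup (geomTorsion W p)) :
    W.borelField C = IntermediateField.fixedField (W.borelKernel C) := rfl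

/-- `K(χ₁, χ₂) ⊆ K(E[p])` (the Borel kernel contains `Γ_{K(E[p])}`). [cite: SilvermanAEC2009, VIII.§1 (the field K(E[m]))] -/
theorem borelField_le_divisionField (C : AddSubgroup (geomTorsion W p)) :
    W.borelField C ≤ W.divisionField p :=
  IntermediateField.fixedField_le (fixingSubgroupOfModule_le_borelKernel C)

section CharZero

variable [CharZero K]

/-- The fixing group of `K(χ₁, χ₂)` is the Borel kernel (open subgroups are closed; Krull's
correspondence). [cite: SilvermanAEC2009, VIII.§1 (K(E[m])/K finite Galois)] -/
theorem fixingSubgroup_borelField [W.IsElliptic] [NeZero p] (C : AddSubgroup (geomTorsion W p)) :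
    ((W.borelField C).fixingSubgroup : Subgroup (absoluteGaloisGroup K)) = W.borelKernel C :=
  fixingSubgroup_fixedField_of_isOpen _ (isOpen_borelKernel C)

/-- `K(χ₁, χ₂)/K` is finite (a subfield of `K(E[p])`). [cite: SilvermanAEC2009, VIII.§1 (K(E[m])/K finite Galois)] -/
theorem finiteDimensional_borelField [W.IsElliptic] [NeZero p] (C : AddSubgroup (geomTorsion W p)) :
    FiniteDimensional K (W.borelField C) :=
  finiteDimensional_fixedField_of_isOpen _ (isOpen_borelKernel C)

/-- `[K(χ₁, χ₂) : K] = [Γ_K : borelKernel C]` (Krull's correspondence for open subgroups). [cite: SilvermanAEC2009, VIII.§1 (K(E[m])/K finite Galois)] -/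
theorem finrank_borelField [W.IsElliptic] [NeZero p] (C : AddSubgroup (geomTorsion W p)) :
    Module.finrank K (W.borelField C) = (W.borelKernel C).index :=
  finrank_fixedField_of_isOpen _ (isOpen_borelKernel C)

/-- `[K(E[p]) : K] = [Γ_K : Γ_{K(E[p])}]` (`Gal(K(E[p])/K) ≅ im ρ̄`). [cite: SilvermanAEC2009, VIII.§1 (K(E[m])/K finite Galois)] [cite: SerreAbelianLadic1968, IV.1.1–1.2] -/
theorem finrank_divisionField [W.IsElliptic] [NeZero p] :
    Module.finrank K (W.divisionField p) = (fixingSubgroupOfModule K (geomTorsion W p)).index :=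
  finrank_fixedField_of_isOpen _ (W.isOpen_fixingSubgroupOfModule_geomTorsion p)

/-- `K(χ₁, χ₂)/K` is Galois when `C` is stable (normal open fixing group). [cite: Wuthrich2014, Lemma 14 (p. 396), proof] [cite: SilvermanAEC2009, VIII.§1] -/
theorem isGalois_borelField [W.IsElliptic] [NeZero p] {C : AddSubgroup (geomTorsion W p)}
    (hC : ∀ (σ : absoluteGaloisGroup K) (x : geomTorsion W p), x ∈ C → σ • x ∈ C) :
    IsGalois K (W.borelField C) := by
  haveI : IsGalois K (AlgebraicClosure K) := {}
  rw [← InfiniteGalois.normal_iff_isGalois, fixingSubgroup_borelField]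
  exact borelKernel_normal hC

omit [CharZero K] in
/-- Restriction to a subfield `L ⊆ K̄` kills the fixing group of `L`. [folklore] -/
private theorem absRestrictNormalHom_eq_one_of_mem_fixingSubgroup
    (L : IntermediateField K (AlgebraicClosure K)) [Normal K L] {σ : absoluteGaloisGroup K}
    (hσ : σ ∈ (L.fixingSubgroup : Subgroup (absoluteGaloisGroup K))) :
    absRestrictNormalHom L σ = 1 := by
  rw [mem_fixingSubgroup_iff_forall_smul] at hσ
  change AlgEquiv.restrictNormalHom _ (absoluteGaloisGroup.toAlgEquiv K σ) = 1
  ext x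
  rw [AlgEquiv.one_apply, AlgEquiv.restrictNormalHom_apply]
  exact hσ x

/-- Restriction `Γ_K → Gal(L/K)` is onto for `L ⊆ K̄` normal over `K`. [folklore] -/
private theorem absRestrictNormalHom_surjective_of_normal (L : IntermediateField K (AlgebraicClosure K))
    [Normal K L] : Function.Surjective (absRestrictNormalHom L) :=
  (AlgEquiv.restrictNormalHom_surjective (AlgebraicClosure K)).comp
    (absoluteGaloisGroup.toAlgEquiv K).surjective

/-- **`K(χ₁, χ₂)/K` is ABELIAN** for a stable line `C` of a reducible `E[p]` (`#C = p`, `#E[p] = p²`):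
its Galois group is a quotient of `Γ_K/borelKernel`, which is commutative by
`commutator_mem_borelKernel`.  This is the sentence «the two characters of `E[p]` cut out abelian
fields» of Wuthrich's Lemma 14. [cite: Wuthrich2014, Lemma 14 (p. 396)] -/
theorem isAbelianGalois_borelField [W.IsElliptic] [Fact p.Prime] {C : AddSubgroup (geomTorsion W p)}
    (hC : ∀ (σ : absoluteGaloisGroup K) (x : geomTorsion W p), x ∈ C → σ • x ∈ C)
    (hcard : Nat.card C = p) (hV : Nat.card (geomTorsion W p) = p ^ 2) :
    IsAbelianGalois K (W.borelField C) := by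
  haveI : NeZero p := ⟨(Fact.out : p.Prime).ne_zero⟩
  haveI : IsGalois K (W.borelField C) := isGalois_borelField hC
  haveI : IsMulCommutative ((W.borelField C) ≃ₐ[K] (W.borelField C)) := by
    refine ⟨⟨fun φ ψ => ?_⟩⟩
    obtain ⟨σ, rfl⟩ := absRestrictNormalHom_surjective_of_normal (W.borelField C) φ
    obtain ⟨τ, rfl⟩ := absRestrictNormalHom_surjective_of_normal (W.borelField C) ψ
    have hcomm : σ * τ * σ⁻¹ * τ⁻¹ ∈ ((W.borelField C).fixingSubgroup : Subgroup (absoluteGaloisGroup K)) := by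
      rw [fixingSubgroup_borelField]
      exact commutator_mem_borelKernel hC hcard hV σ τ
    have h1 := absRestrictNormalHom_eq_one_of_mem_fixingSubgroup (W.borelField C) hcomm
    rw [map_mul, map_mul, map_mul, map_inv, map_inv, mul_inv_eq_one, mul_inv_eq_iff_eq_mul] at h1
    exact h1
  exact {}

end CharZero

/-! ### The degree `[K(E[p]) : K(χ₁, χ₂)]` divides `p` -/

section Degree

variable {C : AddSubgroup (geomTorsion W p)}

/-- On the Borel kernel, `σ ↦ σy₀ − y₀` is a homomorphism to `E[p]` (with values in `C`): for
`σ, τ` fixing `C` pointwise, `στy₀ − y₀ = (τy₀ − y₀) + (σy₀ − y₀)` — the off-diagonal entry `h` of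
`ρ̄ = (χ₁ h; 0 χ₂)` restricted to `ker(χ₁, χ₂)`. [cite: Wuthrich2014, Lemma 14 (p. 396), proof] [cite: SerreAbelianLadic1968, IV.1.1–1.2] -/
def borelKernelCocycle (C : AddSubgroup (geomTorsion W p)) (y₀ : geomTorsion W p) :
    W.borelKernel C →* Multiplicative (geomTorsion W p) where
  toFun σ := Multiplicative.ofAdd ((σ : absoluteGaloisGroup K) • y₀ - y₀)
  map_one' := by simp
  map_mul' σ τ := by
    rw [← ofAdd_add]
    congr 1
    obtain ⟨hσC, -⟩ := σ.2
    obtain ⟨-, hτV⟩ := τ.2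
    have h1 : (σ : absoluteGaloisGroup K) • ((τ : absoluteGaloisGroup K) • y₀ - y₀) =
        (τ : absoluteGaloisGroup K) • y₀ - y₀ := hσC _ (hτV y₀)
    rw [Subgroup.coe_mul, mul_smul, ← h1, smul_sub]
    abel

/-- Unfolding of `borelKernelCocycle`. [cite: Wuthrich2014, Lemma 14 (p. 396), proof] -/
theorem borelKernelCocycle_apply (C : AddSubgroup (geomTorsion W p)) (y₀ : geomTorsion W p)
    (σ : W.borelKernel C) :
    borelKernelCocycle C y₀ σ = Multiplicative.ofAdd ((σ : absoluteGaloisGroup K) • y₀ - y₀) := rfl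

/-- The kernel of `σ ↦ σy₀ − y₀` on the Borel kernel is `Γ_{K(E[p])}` (`y₀ ∉ C`, `#C = p`, `#E[p] = p²`:
`E[p] = C + ℤy₀`). [cite: Wuthrich2014, Lemma 14 (p. 396), proof] [cite: SerreAbelianLadic1968, IV.1.1–1.2] -/
theorem ker_borelKernelCocycle_eq [Fact p.Prime] (hcard : Nat.card C = p)
    (hV : Nat.card (geomTorsion W p) = p ^ 2) {y₀ : geomTorsion W p} (hy₀ : y₀ ∉ C) :
    (borelKernelCocycle C y₀).ker =
      (fixingSubgroupOfModule K (geomTorsion W p)).subgroupOf (W.borelKernel C) := by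
  ext σ
  rw [MonoidHom.mem_ker, Subgroup.mem_subgroupOf, mem_fixingSubgroupOfModule_geomTorsion_iff,
    borelKernelCocycle_apply, ← ofAdd_zero, Multiplicative.ofAdd.apply_eq_iff_eq, sub_eq_zero]
  constructor
  · intro hσy₀ y
    have hy : y ∈ C ⊔ AddSubgroup.zmultiples y₀ := by
      rw [sup_zmultiples_eq_top_of_not_mem hcard hV hy₀]; exact AddSubgroup.mem_top _
    obtain ⟨c, hc, z, hz, rfl⟩ := AddSubgroup.mem_sup.mp hy
    obtain ⟨k, rfl⟩ := AddSubgroup.mem_zmultiples_iff.mp hz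
    rw [smul_add, σ.2.1 c hc, smul_zsmul_geomTorsion, hσy₀]
  · intro h
    exact h y₀

/-- **`[Γ_{K(χ₁,χ₂)} : Γ_{K(E[p])}]` divides `p`**: the Borel kernel modulo `Γ_{K(E[p])}` embeds in
`C ≅ ℤ/p` by `σ ↦ σy₀ − y₀`. [cite: Lim2017FineSelmer, §3 Remark (a) (arXiv:1306.2047 p. 7)]
[cite: Wuthrich2014, Lemma 14 (p. 396)] -/
theorem relIndex_fixingSubgroupOfModule_borelKernel_dvd [hp : Fact p.Prime]
    (hcard : Nat.card C = p) (hV : Nat.card (geomTorsion W p) = p ^ 2) :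
    (fixingSubgroupOfModule K (geomTorsion W p)).relIndex (W.borelKernel C) ∣ p := by
  -- pick `y₀ ∉ C`
  have hCtop : C ≠ ⊤ := by
    intro h
    have h1 : Nat.card C = Nat.card (geomTorsion W p) := by
      rw [h]; exact Nat.card_congr (AddSubgroup.topEquiv.toEquiv)
    rw [hcard, hV] at h1
    have := hp.out.one_lt
    nlinarith
  obtain ⟨y₀, hy₀⟩ : ∃ y₀ : geomTorsion W p, y₀ ∉ C := by
    by_contra h
    push Not at h
    exact hCtop (eq_top_iff.mpr fun y _ => h y)
  have hker := ker_borelKernelCocycle_eq hcard hV hy₀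
  have hidx : (fixingSubgroupOfModule K (geomTorsion W p)).relIndex (W.borelKernel C) =
      Nat.card (borelKernelCocycle C y₀).range := by
    rw [Subgroup.relIndex, ← hker]
    exact Subgroup.index_ker _
  rw [hidx]
  -- the range consists of elements of `C`
  have hle : (borelKernelCocycle C y₀).range ≤
      (AddSubgroup.toSubgroup C : Subgroup (Multiplicative (geomTorsion W p))) := by
    rintro _ ⟨σ, rfl⟩
    exact σ.2.2 y₀
  have h := Subgroup.card_dvd_of_le hle
  have hC' : Nat.card (AddSubgroup.toSubgroup C : Subgroup (Multiplicative (geomTorsion W p))) = p :=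
    hcard
  rwa [hC'] at h

variable [CharZero K]

/-- **`[K(E[p]) : K] = p^k · [K(χ₁, χ₂) : K]` with `k ≤ 1`** (`#C = p`, `#E[p] = p²`): the division
field is an extension of the abelian Borel field of degree `1` or `p`.
[cite: Lim2017FineSelmer, §3 Remark (a) (arXiv:1306.2047 p. 7)] [cite: Wuthrich2014, Lemma 14 (p. 396)] -/
theorem exists_finrank_divisionField_eq_pow_mul_finrank_borelField [W.IsElliptic] [hp : Fact p.Prime]
    (hcard : Nat.card C = p) (hV : Nat.card (geomTorsion W p) = p ^ 2) :
    ∃ k : ℕ, k ≤ 1 ∧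
      Module.finrank K (W.divisionField p) = p ^ k * Module.finrank K (W.borelField C) := by
  haveI : NeZero p := ⟨hp.out.ne_zero⟩
  have hmul := Subgroup.relIndex_mul_index (fixingSubgroupOfModule_le_borelKernel C)
  rw [finrank_divisionField, finrank_borelField, ← hmul]
  rcases (Nat.dvd_prime hp.out).mp (relIndex_fixingSubgroupOfModule_borelKernel_dvd hcard hV)
    with h | h
  · exact ⟨0, zero_le_one, by rw [h, pow_zero]⟩
  · exact ⟨1, le_rfl, by rw [h, pow_one]⟩

end Degree

/-! ### Packaging for a reducible `E[p]` over a number field -/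

/-- `#E[p] = p²` over a field of characteristic zero (the tree's `card_torsionBy_eq_sq` on `E(K̄)`).
[cite: SilvermanAEC2009, Cor. III.6.4 (b)] -/
theorem natCard_geomTorsion_eq_sq_of_charZero [CharZero K] [W.IsElliptic] (hp : p.Prime) :
    Nat.card (geomTorsion W p) = p ^ 2 := by
  haveI : (W.baseChange (AlgebraicClosure K)).IsElliptic :=
    inferInstanceAs (W.map (algebraMap K (AlgebraicClosure K))).IsElliptic
  haveI : CharZero (AlgebraicClosure K) :=
    charZero_of_injective_algebraMap (algebraMap K (AlgebraicClosure K)).injective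
  have hpne : ((p : ℕ) : AlgebraicClosure K) ≠ 0 := by exact_mod_cast hp.ne_zero
  exact card_torsionBy_eq_sq (E := W.baseChange (AlgebraicClosure K)) hpne

/-- A reducible `E[p]` has a stable subgroup `C ≠ ⊥, ⊤` (unfolding of `HasIrreducibleModPGaloisRep`).
[folklore] -/
private theorem exists_stable_of_not_hasIrreducibleModPGaloisRep
    (h : ¬ W.HasIrreducibleModPGaloisRep p) :
    ∃ C : AddSubgroup (geomTorsion W p),
      (∀ (σ : absoluteGaloisGroup K) (x : geomTorsion W p), x ∈ C → σ • x ∈ C) ∧ C ≠ ⊥ ∧ C ≠ ⊤ := by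
  unfold HasIrreducibleModPGaloisRep at h
  push Not at h
  obtain ⟨C, hC, h1, h2⟩ := h
  exact ⟨C, fun σ x hx => hC σ x hx, h1, h2⟩

/-- **A reducible `E[p]` makes `K(E[p])` a `p`-extension of a finite ABELIAN Galois extension of `K`**
(`K` of characteristic `0`, `E/K` elliptic, `p` prime): there is `M ⊆ K(E[p])` (namely
`M = K(χ₁, χ₂)`, the Borel field of a stable line), finite, Galois and abelian over `K`, with
`[K(E[p]) : K] = p^k · [M : K]`, `k ≤ 1`.  The kernel half of Wuthrich 2014 Lemma 14 / Coates–Sujatha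
2005 Cor. 3.6 / Lim 2017 Remark (a). [cite: Wuthrich2014, Lemma 14 (p. 396)]
[cite: Lim2017FineSelmer, §3 Theorem after the main theorem, and Remark (a) (arXiv:1306.2047 p. 7)] -/
theorem exists_abelian_le_divisionField_of_not_irreducible [CharZero K] [W.IsElliptic]
    [hp : Fact p.Prime] (h : ¬ W.HasIrreducibleModPGaloisRep p) :
    ∃ M : IntermediateField K (AlgebraicClosure K),
      M ≤ W.divisionField p ∧ FiniteDimensional K M ∧ IsAbelianGalois K M ∧
        ∃ k : ℕ, k ≤ 1 ∧ Module.finrank K (W.divisionField p) = p ^ k * Module.finrank K M := by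
  haveI : NeZero p := ⟨hp.out.ne_zero⟩
  obtain ⟨C, hC, h1, h2⟩ := exists_stable_of_not_hasIrreducibleModPGaloisRep h
  have hV := natCard_geomTorsion_eq_sq_of_charZero (W := W) hp.out
  have hcard := card_eq_of_ne_bot_of_ne_top hV h1 h2
  exact ⟨W.borelField C, borelField_le_divisionField C, finiteDimensional_borelField C,
    isAbelianGalois_borelField hC hcard hV,
    exists_finrank_divisionField_eq_pow_mul_finrank_borelField hcard hV⟩

end WeierstrassCurve

end
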